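import Mathlib
import HarnessLib
import Summits.CriticalPhenomena.Ising3DConformalLimit.Theorems.PrecisionLaplacianDirectCorrelationStableTailPointwiseUpgradeAux

/-!
# Stub `stub_scalingOfStableTail` of line `self-energy-pick-inversion`
(crux `PrecisionLaplacian.DirectCorrelationStableTail`, item stmt-CriticalPhenomena-4799)

NECESSITY of the (reshaped) core: a pointwise STABLE TAIL of a lattice function `a : ℤ³ → ℝ`,
`a(x) |x|₂^{5-η} − Φ(x/|x|₂) → 0` along the cofinite filter, with `Φ` continuous on the Euclidean unit
sphere, implies STABLE LÉVY SCALING with index `2 − η` and angular profile `Φ`: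
`R^{2-η} ∑_x a(x) f(x/R) → ∫ f(y) Φ(y/|y|₂) |y|₂^{-(5-η)} dy` (`R → ∞` in `ℕ`) for every continuous
compactly supported `f` with `0 ∉ tsupport f`.  No sign or range assumption on `a`, `Φ`, `η`.

Proof (folklore).  Let `F(y) = f(y) Φ(y/|y|₂) |y|₂^{-(5-η)}`; since `f` vanishes on a ball `‖y‖ < ρ`,
`F` is continuous with compact support, so the lattice Riemann sums `R⁻³ ∑_x F(x/R)` converge to `∫ F`
(`tendsto_lattice_sum_div_cube`).  Termwise, with `|x/R|₂ = |x|₂/R`, `(x/R)^ = x̂` and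
`R^{2-η} = (|x|₂/R)^{-(5-η)} |x|₂^{5-η} R⁻³`,
`R^{2-η} a(x) f(x/R) − R⁻³ F(x/R) = R⁻³ f(x/R) |x/R|₂^{-(5-η)} · (a(x)|x|₂^{5-η} − Φ(x̂))`,
and on the support `ρ ≤ |x/R|₂ ≤ 2M`, so the difference of the two sums is at most
`C₁ · sup_{|x|₂ ≥ ρR} |a(x)|x|₂^{5-η} − Φ(x̂)| · R⁻³ ∑_x |f(x/R)| → 0`.
-/

noncomputable section

namespace Summit.CriticalPhenomena.Ising3DConformalLimit.Cruxes.DirectCorrelationStableTail.SelfEnergyPickInversion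

open MeasureTheory Filter Topology
open scoped BigOperators
open Literature.Probability.LatticeModels

/-! ### Elementary rescaling identities -/

/-- Euclidean norm of a rescaled lattice point: `|x / c|₂ = |x|₂ / c` for `c > 0`. [folklore] -/
theorem sqrt_sum_sq_intCast_div (x : Site 3) {c : ℝ} (hc : 0 < c) :
    √(∑ l, ((x l : ℝ) / c) ^ 2) = √(∑ l, ((x l : ℝ)) ^ 2) / c := by
  simp_rw [div_pow]
  rw [← Finset.sum_div, Real.sqrt_div' _ (sq_nonneg c), Real.sqrt_sq hc.le]

/-- The direction of a rescaled lattice point is the direction of the point (`c > 0`). [folklore] -/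
theorem dir_intCast_div (x : Site 3) {c : ℝ} (hc : 0 < c) :
    (fun j => (x j : ℝ) / c / √(∑ l, ((x l : ℝ) / c) ^ 2)) =
      fun j => (x j : ℝ) / √(∑ l, ((x l : ℝ)) ^ 2) := by
  funext j
  rw [sqrt_sum_sq_intCast_div x hc, div_div_div_cancel_right₀ hc.ne']

/-- Power counting of the rescaling: `R^{2-η} = (s/R)^{-(5-η)} · s^{5-η} / R³` (`R, s > 0`).
[folklore] -/
theorem rpow_two_sub_eq_div_rpow_mul (R s η : ℝ) (hR : 0 < R) (hs : 0 < s) :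
    R ^ (2 - η) = (s / R) ^ (-(5 - η)) * s ^ (5 - η) / R ^ 3 := by
  rw [Real.div_rpow hs.le hR.le, Real.rpow_neg hs.le, Real.rpow_neg hR.le]
  have h5 : R ^ (5 - η) = R ^ (2 - η) * R ^ 3 := by
    rw [← Real.rpow_natCast R 3, ← Real.rpow_add hR]
    congr 1
    push_cast
    ring
  have h1 : s ^ (5 - η) ≠ 0 := (Real.rpow_pos_of_pos hs _).ne'
  have h2 : R ^ (2 - η) ≠ 0 := (Real.rpow_pos_of_pos hR _).ne'
  have h3 : R ^ 3 ≠ 0 := pow_ne_zero 3 hR.ne'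
  rw [h5]
  field_simp

/-- A real power with exponent of either sign is bounded on `[ρ, K]` (`ρ > 0`) by the sum of its two
endpoint values. [folklore] -/
theorem rpow_le_endpoint_rpow_add {ρ K t : ℝ} (hρ : 0 < ρ) (hρt : ρ ≤ t) (htK : t ≤ K) (p : ℝ) :
    t ^ p ≤ ρ ^ p + K ^ p := by
  have ht : 0 < t := hρ.trans_le hρt
  rcases le_total 0 p with hp | hp
  · have h1 : t ^ p ≤ K ^ p := Real.rpow_le_rpow ht.le htK hp
    linarith [Real.rpow_nonneg hρ.le p]
  · have h1 : t ^ p ≤ ρ ^ p := Real.rpow_le_rpow_of_nonpos hρ hρt hp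
    linarith [Real.rpow_nonneg (ht.le.trans htK) p]

/-! ### The limit density cut off by a test function -/

/-- If `f` is continuous and vanishes on the ball `‖y‖ < ρ` (`ρ > 0`) and `Φ` is continuous on the
Euclidean unit sphere, then `y ↦ f(y) · Φ(y/|y|₂) · |y|₂^p` is continuous on `ℝ³`. [folklore] -/
theorem continuous_test_mul_angular_rpow (f : (Fin 3 → ℝ) → ℝ) (Φ : (Fin 3 → ℝ) → ℝ) (p : ℝ)
    (hf : Continuous f) (hΦ : ContinuousOn Φ {u : Fin 3 → ℝ | ∑ i, u i ^ 2 = 1})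
    {ρ : ℝ} (hρ : 0 < ρ) (hfρ : ∀ u, ‖u‖ < ρ → f u = 0) :
    Continuous fun y => f y * (Φ (fun j => y j / √(∑ l, y l ^ 2)) * √(∑ l, y l ^ 2) ^ p) := by
  have hr : Continuous fun y : Fin 3 → ℝ => √(∑ l, y l ^ 2) := Continuous.sqrt (by fun_prop)
  refine continuous_iff_continuousAt.2 fun u => ?_
  by_cases hu : ‖u‖ < ρ
  · -- `F` vanishes on the open ball `‖y‖ < ρ`, a neighbourhood of `u`
    refine Filter.EventuallyEq.continuousAt (y := (0 : ℝ)) ?_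
    filter_upwards [Metric.isOpen_ball.mem_nhds (mem_ball_zero_iff.2 hu)] with y hy
    rw [hfρ y (mem_ball_zero_iff.1 hy), zero_mul]
  · push Not at hu
    have hru : 0 < √(∑ l, u l ^ 2) := (hρ.trans_le hu).trans_le (norm_le_sqrt_sum_sq u)
    have hmem : ∀ y : Fin 3 → ℝ, 0 < √(∑ l, y l ^ 2) →
        (fun j => y j / √(∑ l, y l ^ 2)) ∈ {u : Fin 3 → ℝ | ∑ i, u i ^ 2 = 1} := by
      intro y hy
      have hs : 0 < ∑ l, y l ^ 2 := Real.sqrt_pos.1 hy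
      simp only [Set.mem_setOf_eq, div_pow]
      rw [← Finset.sum_div, Real.sq_sqrt hs.le, div_self hs.ne']
    have hunit : ContinuousAt (fun y : Fin 3 → ℝ => fun j => y j / √(∑ l, y l ^ 2)) u :=
      continuousAt_pi.2 fun j => ((continuous_apply j).continuousAt).div hr.continuousAt hru.ne'
    have hev : ∀ᶠ y in 𝓝 u, 0 < √(∑ l, y l ^ 2) := hr.continuousAt.tendsto.eventually (lt_mem_nhds hru)
    have h1 : Tendsto (fun y : Fin 3 → ℝ => fun j => y j / √(∑ l, y l ^ 2)) (𝓝 u)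
        (𝓝[{u : Fin 3 → ℝ | ∑ i, u i ^ 2 = 1}] fun j => u j / √(∑ l, u l ^ 2)) :=
      tendsto_nhdsWithin_iff.2 ⟨hunit, hev.mono fun y hy => hmem y hy⟩
    have hΦu : ContinuousAt (fun y => Φ (fun j => y j / √(∑ l, y l ^ 2))) u :=
      (hΦ _ (hmem u hru)).tendsto.comp h1
    have hpow : ContinuousAt (fun y => √(∑ l, y l ^ 2) ^ p) u :=
      hr.continuousAt.rpow_const (Or.inl hru.ne')
    exact hf.continuousAt.mul (hΦu.mul hpow)

/-! ### Termwise comparison of the rescaled sum with the Riemann sum of the limit density -/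

/-- Termwise comparison.  If `f ≠ 0` only where `ρ ≤ ‖·‖ ≤ M`, `t^{-(5-η)} ≤ C₁` on `[ρ, 2M]`, and the
stable-tail error is `< ε` outside the Euclidean ball of radius `δ ≤ ρ n`, then for every lattice point
`|n^{2-η} a(x) f(x/n) − f(x/n) Φ((x/n)^) |x/n|₂^{-(5-η)} / n³| ≤ ‖f(x/n)‖ C₁ ε / n³`. [folklore] -/
theorem abs_rescaled_sub_riemann_term_le
    (a : Site 3 → ℝ) (η : ℝ) (Φ : (Fin 3 → ℝ) → ℝ) (f : (Fin 3 → ℝ) → ℝ)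
    {ρ M C₁ ε δ : ℝ} {n : ℕ} (hρ : 0 < ρ) (hn : 0 < n)
    (hfρ : ∀ u, f u ≠ 0 → ρ ≤ ‖u‖) (hfM : ∀ u, f u ≠ 0 → ‖u‖ ≤ M)
    (hC₁ : ∀ t, ρ ≤ t → t ≤ 2 * M → t ^ (-(5 - η)) ≤ C₁)
    (hδ : ∀ x : Site 3, δ ≤ √(∑ j, ((x j : ℝ)) ^ 2) →
      |a x * √(∑ j, ((x j : ℝ)) ^ 2) ^ (5 - η) - Φ (fun i => (x i : ℝ) / √(∑ j, ((x j : ℝ)) ^ 2))| < ε)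
    (hδn : δ ≤ ρ * n) (x : Site 3) :
    |(n : ℝ) ^ (2 - η) * (a x * f (fun j => (x j : ℝ) / (n : ℝ))) -
        f (fun j => (x j : ℝ) / (n : ℝ)) *
          (Φ (fun j => (x j : ℝ) / (n : ℝ) / √(∑ l, ((x l : ℝ) / (n : ℝ)) ^ 2)) *
            √(∑ l, ((x l : ℝ) / (n : ℝ)) ^ 2) ^ (-(5 - η))) / (n : ℝ) ^ 3| ≤
      ‖f (fun j => (x j : ℝ) / (n : ℝ))‖ * (C₁ * ε) / (n : ℝ) ^ 3 := by
  have hn' : (0 : ℝ) < n := by exact_mod_cast hn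
  by_cases hfv : f (fun j => (x j : ℝ) / (n : ℝ)) = 0
  · simp [hfv]
  -- on the support: `ρ ≤ |x/n|₂ ≤ 2M`, `|x|₂ = n |x/n|₂ ≥ ρ n ≥ δ`
  have hρr : ρ ≤ √(∑ l, ((x l : ℝ) / (n : ℝ)) ^ 2) :=
    (hfρ _ hfv).trans (norm_le_sqrt_sum_sq fun j => (x j : ℝ) / (n : ℝ))
  have hr2M : √(∑ l, ((x l : ℝ) / (n : ℝ)) ^ 2) ≤ 2 * M :=
    (sqrt_sum_sq_le_two_mul_norm fun j => (x j : ℝ) / (n : ℝ)).trans (by linarith [hfM _ hfv])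
  have hrpos : 0 < √(∑ l, ((x l : ℝ) / (n : ℝ)) ^ 2) := hρ.trans_le hρr
  have hC : √(∑ l, ((x l : ℝ) / (n : ℝ)) ^ 2) ^ (-(5 - η)) ≤ C₁ := hC₁ _ hρr hr2M
  have hr : √(∑ l, ((x l : ℝ) / (n : ℝ)) ^ 2) = √(∑ l, ((x l : ℝ)) ^ 2) / n :=
    sqrt_sum_sq_intCast_div x hn'
  have hX : √(∑ l, ((x l : ℝ)) ^ 2) = √(∑ l, ((x l : ℝ) / (n : ℝ)) ^ 2) * n := by
    rw [hr, div_mul_cancel₀ _ hn'.ne']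
  have hxpos : 0 < √(∑ l, ((x l : ℝ)) ^ 2) := by
    rw [hX]
    exact mul_pos hrpos hn'
  have hδx : δ ≤ √(∑ l, ((x l : ℝ)) ^ 2) :=
    calc δ ≤ ρ * n := hδn
      _ ≤ √(∑ l, ((x l : ℝ) / (n : ℝ)) ^ 2) * n := mul_le_mul_of_nonneg_right hρr hn'.le
      _ = √(∑ l, ((x l : ℝ)) ^ 2) := hX.symm
  have htail := hδ x hδx
  -- the termwise identity
  have key : (n : ℝ) ^ (2 - η) * (a x * f (fun j => (x j : ℝ) / (n : ℝ))) -
      f (fun j => (x j : ℝ) / (n : ℝ)) *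
        (Φ (fun j => (x j : ℝ) / (n : ℝ) / √(∑ l, ((x l : ℝ) / (n : ℝ)) ^ 2)) *
          √(∑ l, ((x l : ℝ) / (n : ℝ)) ^ 2) ^ (-(5 - η))) / (n : ℝ) ^ 3 =
      f (fun j => (x j : ℝ) / (n : ℝ)) * √(∑ l, ((x l : ℝ) / (n : ℝ)) ^ 2) ^ (-(5 - η)) /
          (n : ℝ) ^ 3 *
        (a x * √(∑ j, ((x j : ℝ)) ^ 2) ^ (5 - η) -
          Φ (fun i => (x i : ℝ) / √(∑ j, ((x j : ℝ)) ^ 2))) := by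
    rw [dir_intCast_div x hn', hr, rpow_two_sub_eq_div_rpow_mul (n : ℝ) _ η hn' hxpos]
    ring
  rw [key, abs_mul, abs_div, abs_mul, abs_of_pos (Real.rpow_pos_of_pos hrpos _),
    abs_of_pos (pow_pos hn' 3), Real.norm_eq_abs]
  have hC₀ : 0 ≤ C₁ := (Real.rpow_nonneg hrpos.le _).trans hC
  have hmain : √(∑ l, ((x l : ℝ) / (n : ℝ)) ^ 2) ^ (-(5 - η)) *
      |a x * √(∑ j, ((x j : ℝ)) ^ 2) ^ (5 - η) - Φ (fun i => (x i : ℝ) / √(∑ j, ((x j : ℝ)) ^ 2))| ≤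
        C₁ * ε :=
    mul_le_mul hC htail.le (abs_nonneg _) hC₀
  calc |f (fun j => (x j : ℝ) / (n : ℝ))| * √(∑ l, ((x l : ℝ) / (n : ℝ)) ^ 2) ^ (-(5 - η)) /
          (n : ℝ) ^ 3 *
        |a x * √(∑ j, ((x j : ℝ)) ^ 2) ^ (5 - η) - Φ (fun i => (x i : ℝ) / √(∑ j, ((x j : ℝ)) ^ 2))|
      = |f (fun j => (x j : ℝ) / (n : ℝ))| * (√(∑ l, ((x l : ℝ) / (n : ℝ)) ^ 2) ^ (-(5 - η)) *
          |a x * √(∑ j, ((x j : ℝ)) ^ 2) ^ (5 - η) -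
            Φ (fun i => (x i : ℝ) / √(∑ j, ((x j : ℝ)) ^ 2))|) / (n : ℝ) ^ 3 := by ring
    _ ≤ |f (fun j => (x j : ℝ) / (n : ℝ))| * (C₁ * ε) / (n : ℝ) ^ 3 :=
      div_le_div_of_nonneg_right (mul_le_mul_of_nonneg_left hmain (abs_nonneg _)) (pow_nonneg hn'.le 3)

/-! ### The stub -/

/-- **Registered stub `stub_scalingOfStableTail`** (line `self-energy-pick-inversion`, crux
stmt-CriticalPhenomena-4799; Ising-free NECESSITY of the core): a pointwise stable tail
`a(x)|x|₂^{5-η} − Φ(x̂) → 0` (cofinitely, `Φ` continuous on `S²`) implies stable Lévy scaling with index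
`2 − η` and profile `Φ`: `R^{2-η} Σ_x a(x) f(x/R) → ∫ f(y) Φ(ŷ)|y|₂^{-(5-η)} dy` for every
`f ∈ C_c(ℝ³ ∖ 0)`.  Proof: lattice Riemann sums (`tendsto_lattice_sum_div_cube`) for the continuous
compactly supported `y ↦ f(y)Φ(ŷ)|y|₂^{-(5-η)}`, plus the termwise error estimate
`abs_rescaled_sub_riemann_term_le` summed against the bounded Riemann sums of `‖f‖`. [folklore] -/
theorem stub_scalingOfStableTail : ∀ (a : Site 3 → ℝ) (η : ℝ) (Φ : (Fin 3 → ℝ) → ℝ), ContinuousOn Φ {u : Fin 3 → ℝ | ∑ i, u i ^ 2 = 1} → Filter.Tendsto (fun x : Site 3 => a x * Real.sqrt (∑ j, ((x j : ℝ)) ^ 2) ^ (5 - η) - Φ (fun i => (x i : ℝ) / Real.sqrt (∑ j, ((x j : ℝ)) ^ 2))) Filter.cofinite (nhds 0) → ∀ f : (Fin 3 → ℝ) → ℝ, Continuous f → HasCompactSupport f → (0 : Fin 3 → ℝ) ∉ tsupport f → Filter.Tendsto (fun R : ℕ => (R : ℝ) ^ (2 - η) * ∑' x : Site 3, a x * f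 (fun j => (x j : ℝ) / (R : ℝ))) Filter.atTop (nhds (∫ y : Fin 3 → ℝ, f y * (Φ (fun j => y j / Real.sqrt (∑ l, y l ^ 2)) * Real.sqrt (∑ l, y l ^ 2) ^ (-(5 - η))))) := by
  intro a η Φ hΦ htail f hf hfc h0
  -- (1) the support of `f` avoids a ball around `0` and is bounded
  obtain ⟨ρ, hρ, hball⟩ : ∃ ρ > 0, Metric.ball (0 : Fin 3 → ℝ) ρ ⊆ (tsupport f)ᶜ :=
    Metric.isOpen_iff.1 (isClosed_tsupport f).isOpen_compl 0 h0
  have hfball : ∀ u : Fin 3 → ℝ, ‖u‖ < ρ → f u = 0 := fun u hu =>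
    image_eq_zero_of_notMem_tsupport (hball (mem_ball_zero_iff.2 hu))
  have hfρ : ∀ u, f u ≠ 0 → ρ ≤ ‖u‖ := fun u hu => by
    by_contra hlt
    push Not at hlt
    exact hu (hfball u hlt)
  obtain ⟨M₀, hM₀⟩ := isBounded_iff_forall_norm_le.1 hfc.isCompact.isBounded
  set M : ℝ := max M₀ 1 with hMdef
  have hM1 : 1 ≤ M := le_max_right _ _
  have hfM : ∀ u, f u ≠ 0 → ‖u‖ ≤ M := fun u hu =>
    (hM₀ u (subset_tsupport f (Function.mem_support.2 hu))).trans (le_max_left _ _)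
  -- (2) the limit density integrand and its lattice Riemann sums
  set F : (Fin 3 → ℝ) → ℝ := fun y =>
    f y * (Φ (fun j => y j / √(∑ l, y l ^ 2)) * √(∑ l, y l ^ 2) ^ (-(5 - η))) with hFdef
  have hFc : HasCompactSupport F := hfc.mul_right
  have hFcont : Continuous F := continuous_test_mul_angular_rpow f Φ (-(5 - η)) hf hΦ hρ hfball
  have hRiem : Tendsto (fun n : ℕ => (∑' y : Site 3, F (fun j => (y j : ℝ) / (n : ℝ))) / (n : ℝ) ^ 3)
      atTop (𝓝 (∫ v, F v)) := tendsto_lattice_sum_div_cube F hFcont hFc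
  -- (3) the difference of the rescaled sums and the Riemann sums tends to `0`
  have hD : Tendsto (fun n : ℕ => (n : ℝ) ^ (2 - η) * ∑' x : Site 3, a x * f (fun j => (x j : ℝ) / (n : ℝ)) -
      (∑' y : Site 3, F (fun j => (y j : ℝ) / (n : ℝ))) / (n : ℝ) ^ 3) atTop (𝓝 0) := by
    set C₁ : ℝ := ρ ^ (-(5 - η)) + (2 * M) ^ (-(5 - η)) with hC₁def
    have hC₁pos : 0 < C₁ :=
      add_pos (Real.rpow_pos_of_pos hρ _) (Real.rpow_pos_of_pos (by linarith) _)
    have hC₁ : ∀ t, ρ ≤ t → t ≤ 2 * M → t ^ (-(5 - η)) ≤ C₁ := fun t h1 h2 =>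
      rpow_le_endpoint_rpow_add hρ h1 h2 _
    -- the Riemann sums of `‖f‖` are eventually bounded by `I = ∫ ‖f‖ + 1`
    have hnorm : Tendsto (fun n : ℕ => (∑' y : Site 3, ‖f (fun j => (y j : ℝ) / (n : ℝ))‖) / (n : ℝ) ^ 3)
        atTop (𝓝 (∫ v, ‖f v‖)) := tendsto_lattice_sum_div_cube (fun u => ‖f u‖) hf.norm hfc.norm
    set I : ℝ := (∫ v, ‖f v‖) + 1 with hIdef
    have hI : 0 < I := add_pos_of_nonneg_of_pos (integral_nonneg fun v => norm_nonneg _) one_pos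
    have hltI : (∫ v, ‖f v‖) < I := by linarith
    obtain ⟨N₁, hN₁⟩ := eventually_atTop.1 (hnorm.eventually (gt_mem_nhds hltI))
    rw [Metric.tendsto_atTop]
    intro ε' hε'
    obtain ⟨ε, hε, hεeq⟩ : ∃ ε : ℝ, 0 < ε ∧ I * (C₁ * ε) = ε' / 2 :=
      ⟨ε' / 2 / (I * C₁), by positivity, by field_simp⟩
    -- the stable-tail error is `< ε` outside a Euclidean ball of radius `δ`
    have hev : ∀ᶠ x : Site 3 in cofinite, |a x * √(∑ j, ((x j : ℝ)) ^ 2) ^ (5 - η) -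
        Φ (fun i => (x i : ℝ) / √(∑ j, ((x j : ℝ)) ^ 2))| < ε := by
      have h := (Metric.tendsto_nhds.1 htail) ε hε
      simpa only [Real.dist_0_eq_abs] using h
    obtain ⟨δ, hδ⟩ := exists_radius_of_eventually_cofinite hev
    obtain ⟨N₂, hN₂⟩ := exists_nat_ge (δ / ρ)
    refine ⟨max (max N₁ N₂) 1, fun n hn => ?_⟩
    obtain ⟨hn12, hn1⟩ := max_le_iff.1 hn
    obtain ⟨hnN₁, hnN₂⟩ := max_le_iff.1 hn12
    have hnpos : 0 < n := hn1
    have hn' : (0 : ℝ) < n := by exact_mod_cast hnpos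
    have hδn : δ ≤ ρ * n := by
      have hN₂n : (N₂ : ℝ) ≤ n := by exact_mod_cast hnN₂
      have h := (div_le_iff₀ hρ).1 (hN₂.trans hN₂n)
      linarith
    rw [Real.dist_0_eq_abs]
    -- all sums are finite sums over one finite set `B`
    obtain ⟨B, hB⟩ := exists_finset_support_rescaled f hfc hnpos
    have h1 : ∑' x : Site 3, a x * f (fun j => (x j : ℝ) / (n : ℝ)) =
        ∑ x ∈ B, a x * f (fun j => (x j : ℝ) / (n : ℝ)) :=
      tsum_eq_sum fun x hx => by rw [hB x hx, mul_zero]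
    have h2 : ∑' y : Site 3, F (fun j => (y j : ℝ) / (n : ℝ)) = ∑ y ∈ B, F (fun j => (y j : ℝ) / (n : ℝ)) :=
      tsum_eq_sum fun x hx => by simp only [hFdef]; rw [hB x hx, zero_mul]
    have h3 : ∑' y : Site 3, ‖f (fun j => (y j : ℝ) / (n : ℝ))‖ = ∑ y ∈ B, ‖f (fun j => (y j : ℝ) / (n : ℝ))‖ :=
      tsum_eq_sum fun x hx => by rw [hB x hx, norm_zero]
    have hS : (∑ y ∈ B, ‖f (fun j => (y j : ℝ) / (n : ℝ))‖) / (n : ℝ) ^ 3 < I := by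
      have h : (∑' y : Site 3, ‖f (fun j => (y j : ℝ) / (n : ℝ))‖) / (n : ℝ) ^ 3 < I := hN₁ n hnN₁
      rwa [h3] at h
    rw [h1, h2, Finset.mul_sum, Finset.sum_div, ← Finset.sum_sub_distrib]
    calc |∑ x ∈ B, ((n : ℝ) ^ (2 - η) * (a x * f (fun j => (x j : ℝ) / (n : ℝ))) -
            F (fun j => (x j : ℝ) / (n : ℝ)) / (n : ℝ) ^ 3)|
        ≤ ∑ x ∈ B, |(n : ℝ) ^ (2 - η) * (a x * f (fun j => (x j : ℝ) / (n : ℝ))) -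
            F (fun j => (x j : ℝ) / (n : ℝ)) / (n : ℝ) ^ 3| := Finset.abs_sum_le_sum_abs _ _
      _ ≤ ∑ x ∈ B, ‖f (fun j => (x j : ℝ) / (n : ℝ))‖ * (C₁ * ε) / (n : ℝ) ^ 3 :=
          Finset.sum_le_sum fun x _ =>
            abs_rescaled_sub_riemann_term_le a η Φ f hρ hnpos hfρ hfM hC₁ hδ hδn x
      _ = (∑ x ∈ B, ‖f (fun j => (x j : ℝ) / (n : ℝ))‖) / (n : ℝ) ^ 3 * (C₁ * ε) := by
          rw [Finset.sum_div, Finset.sum_mul]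
          exact Finset.sum_congr rfl fun x _ => by ring
      _ ≤ I * (C₁ * ε) := mul_le_mul_of_nonneg_right hS.le (mul_pos hC₁pos hε).le
      _ = ε' / 2 := hεeq
      _ < ε' := half_lt_self hε'
  -- (4) conclusion
  have hsum := hD.add hRiem
  rw [zero_add] at hsum
  exact hsum.congr fun n => sub_add_cancel _ _

end Summit.CriticalPhenomena.Ising3DConformalLimit.Cruxes.DirectCorrelationStableTail.SelfEnergyPickInversion

end
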